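import Literature.Probability.Percolation.TrapPairContract
import Literature.Probability.Percolation.TrapFencedExit
import HarnessLib

/-!
# The fenced exit of a clean route of the pair step

Topic `Literature/Probability/Percolation`; family `crit-perc` / near-critical percolation on `𝕋`.
A brick of the near-critical arm-separation theorem for four arms in the ADJACENT colour
arrangement (P. Nolin, EJP 13 (2008), Thm. 11, `j = 4`, `σ = BBWW` [arXiv 0711.4948: Thm. 10];
the input `hsepAdj` of `Werner2009_lemma63_of_altSeparation_of_adjSeparation`).

A clean route `S ∋ a i ⇝ m_u` of the pair step (`PairData.exists_two_clean_routes`,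
`TrapPairContract.lean`: sites in the arms, the terms, and the connection of the fence of the term
`u` only) together with the fence of `u` (corner crossing through `m_u`) is a fenced exit
(`TrapFencedExit`, `TrapFencedExit.lean`) of the configuration of the pair step, to which the
landing moves `rot_exit_landing_move_row/_two` apply:

* `PairData.clean_route_region` — a clean route lies in `({n ≤ |v| ≤ 2M} ∪ trapFrameZone M z k_u) ∩ χ`;
* `PairData.exitOfRoute` — the fenced exit (tip `z_u`, scale index `jOf`, fence site `m_u`, start
  `a i`), with its projections (`exitOfRoute_z/_m/_a/_k`).

Everything here is proved; no named facts are introduced.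

## References

* P. Nolin, Near-critical percolation in two dimensions, *Electron. J. Probab.* 13 (2008), §4.2
  Def. 6–8, §4.4 proof of Lemma 15 (arXiv 0711.4948: Def. 6–8, Lemma 14) [Nolin2008].
-/

noncomputable section

open Set

namespace Literature.Probability.Percolation

open LatticeModels

namespace PairData

variable {M n k₀ K T : ℕ} {χ : SiteConfig (Site 2)}

/-- **A clean route lies in the annulus `{n ≤ |v| ≤ 2M}` or in the fence zone of its term, and is
open.** [folklore] -/
theorem clean_route_region (D : PairData M n k₀ K T χ) {u : ℕ} {c : Finset (Site 2)} {z : Site 2}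
    (hu : (trapDomain M).lowestSeq χ u = some (c, z)) {S : Set (Site 2)} (hS : S ⊆ D.Bset ∪ (D.fence hu).F) :
    S ⊆ (triAnnSet n (2 * M) ∪ trapFrameZone M z (D.kOf hu)) ∩ χ := fun v hv => by
  refine ⟨?_, D.Aset_subset (D.clean_route_subset_Aset hu hS hv)⟩
  rcases hS hv with (⟨i', hv'⟩ | ⟨u', c', z', hu', h⟩) | h
  · exact Or.inl (D.supp i' v hv').1
  · exact Or.inl (trapD_subset_triAnnSet D.hnM (Finset.mem_coe.2 ((term_isCrossing hu').subset (Finset.mem_coe.1 h))))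
  · exact Or.inr ((D.fence hu).F_subset h).1.1.1

/-- **The fenced exit of a clean route**: the tip `z_u` and scale index of the term, the fence
site `m_u`, the start `a i`, the corner crossing of the fence, and the route. [cite: Nolin2008, §4.2 Def. 6–8 and §4.4 (arXiv 0711.4948: Def. 6–8, Lemma 14)] -/
def exitOfRoute (D : PairData M n k₀ K T χ) (i : Fin 2) {u : ℕ} {c : Finset (Site 2)} {z : Site 2}
    (hu : (trapDomain M).lowestSeq χ u = some (c, z)) {S : Set (Site 2)} (hP : PathIn triGraph S (D.a i) (D.fence hu).m)
    (hS : S ⊆ D.Bset ∪ (D.fence hu).F) : TrapFencedExit M n k₀ K χ where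
  z := z
  j := D.jOf hu
  m := (D.fence hu).m
  a := D.a i
  z_mem := tip_mem hu
  j_lt := (D.jOf_spec hu).1
  norm_a := D.norm_a i
  vcross := (D.fence hu).vcross
  path := hP.mono (D.clean_route_region hu hS)

/-- The tip of the exit of a clean route. [folklore] -/
@[simp] theorem exitOfRoute_z (D : PairData M n k₀ K T χ) (i : Fin 2) {u : ℕ} {c : Finset (Site 2)} {z : Site 2}
    (hu : (trapDomain M).lowestSeq χ u = some (c, z)) {S : Set (Site 2)} (hP : PathIn triGraph S (D.a i) (D.fence hu).m)
    (hS : S ⊆ D.Bset ∪ (D.fence hu).F) : (D.exitOfRoute i hu hP hS).z = z := rfl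

/-- The fence site of the exit of a clean route. [folklore] -/
@[simp] theorem exitOfRoute_m (D : PairData M n k₀ K T χ) (i : Fin 2) {u : ℕ} {c : Finset (Site 2)} {z : Site 2}
    (hu : (trapDomain M).lowestSeq χ u = some (c, z)) {S : Set (Site 2)} (hP : PathIn triGraph S (D.a i) (D.fence hu).m)
    (hS : S ⊆ D.Bset ∪ (D.fence hu).F) : (D.exitOfRoute i hu hP hS).m = (D.fence hu).m := rfl

/-- The start of the exit of a clean route. [folklore] -/
@[simp] theorem exitOfRoute_a (D : PairData M n k₀ K T χ) (i : Fin 2) {u : ℕ} {c : Finset (Site 2)} {z : Site 2}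
    (hu : (trapDomain M).lowestSeq χ u = some (c, z)) {S : Set (Site 2)} (hP : PathIn triGraph S (D.a i) (D.fence hu).m)
    (hS : S ⊆ D.Bset ∪ (D.fence hu).F) : (D.exitOfRoute i hu hP hS).a = D.a i := rfl

/-- The scale of the exit of a clean route is the scale of the term. [folklore] -/
@[simp] theorem exitOfRoute_k (D : PairData M n k₀ K T χ) (i : Fin 2) {u : ℕ} {c : Finset (Site 2)} {z : Site 2}
    (hu : (trapDomain M).lowestSeq χ u = some (c, z)) {S : Set (Site 2)} (hP : PathIn triGraph S (D.a i) (D.fence hu).m)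
    (hS : S ⊆ D.Bset ∪ (D.fence hu).F) : (D.exitOfRoute i hu hP hS).k = D.kOf hu := rfl

/-- **The protection of the exit** (recorded separately, since `TrapFencedExit` keeps only the
corner crossing): no closed path of the trapezoid from a top-type boundary site of the `8k`-box about
the tip to outside the `16k`-box. [cite: Nolin2008, §4.4 Lemma 15 (proof) (arXiv 0711.4948: Lemma 14)] -/
theorem exit_protected (D : PairData M n k₀ K T χ) {u : ℕ} {c : Finset (Site 2)} {z : Site 2}
    (hu : (trapDomain M).lowestSeq χ u = some (c, z)) : TrapTipOK M z (D.kOf hu) χ (D.fence hu).m :=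
  ⟨(D.fence hu).vcross, fun _ _ hq hqin ht =>
    (D.raw hu).no_escape (D.one_le_kOf hu) (term_isCrossing hu) (term_open hu) hq hqin ht⟩

end PairData

end Literature.Probability.Percolation
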